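import Summits.ValiantsHypothesis.ValiantsHypothesis.Theorems.BarrierLeverPartitionMinorsHitByVPHiddenStatesShadowRank

/-!
# Route BarrierLever — item `PartitionMinorsHitByVP` (stmt-ValiantsHypothesis-19717), line `hidden_states`:
# THE PAIR SPAN BOUND — pair columns on `n` states against rows of size `≤ 2q+1` span at most `n·N − C(N,2)` dimensions

Helper file (`--supports stmt-ValiantsHypothesis-19717`; cell valiant-natproofs, rung V4, 𝒟-side door (c), line
`hidden_states`, node #1 `stub_universalJoinWide`; prover seat val-np-p3 gen 19). Definition-free apart from bookkeeping
`def`s (features, reduced column-functions, the index and the vectors of a spanning family). Closes NO item: it is the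
pair-level (`t = 2`) SHARPENING of the shadow-rank bound (`…HiddenStatesShadowRank`, count `n·N`) and of the five-row
bound (`…HiddenStatesFiveRank`, count `2n·N`) by the antisymmetric relations — the kernel side of the seat's «pair span
law» (memo HOME/val-np-p3/g19/MEMO-hybrid-valnp3-g19.md §8c: the span has dimension EXACTLY `min(C(n,2), nN − C(N,2))`
in every computed case; this file proves `≤`).

THE BOUND. One table `tx` (`none` = the constant), hidden family `e` with every two-state member inside `S` (`|S| = n`),
rows `u i ⊆ T` of size `≤ s < 2(q+1)`, `N := #{V ⊆ T : |V| ≤ q}`, features `β_p = (∏_{a∈V} tx p a)_V ∈ ℂ^N`. By part 1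
(`ShadowRank.prod_eq_sum_coef`, `t = 2`) every row restricted to the pair columns is a combination of the column-functions
`Ψ_{p,V} : {p, p'} ↦ β_{p'}(V)`. Choose a maximal set `S₀ ⊆ S` of states with linearly independent features (`|S₀| = e ≤ N`)
and coordinates `β_p = Σ_{p₀ ∈ S₀} r(p,p₀) β_{p₀}` (`r = δ` on `S₀`). Then `Ψ_{p,V} = Σ_{p₀} β_{p₀}(V)·Ψ''_{p,p₀}` with
`Ψ''_{p,p₀} : {p,p'} ↦ r(p',p₀)`, and the ANTISYMMETRIC RELATIONS `Σ_p r(p,p₁)Ψ''_{p,p₂} = Σ_p r(p,p₂)Ψ''_{p,p₁}`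
(`psi_relation`) express `Ψ''_{p₂,p₁}` (`p₁ < p₂` in `S₀`) through `Ψ''_{p₁,p₂}` and the `Ψ''_{p,·}`, `p ∉ S₀`. Hence the rows lie
in the span of `#{k : |e k| ≠ 2} + (n − e)e + C(e+1, 2) ≤ #{k : |e k| ≠ 2} + nN − C(N,2)` vectors (`e ≤ N ≤ n`), and
(`det_eq_zero_pairs`): if `#{k : |e k| ≠ 2} + n·N < #columns + C(N,2)` (with `N ≤ n`) the matrix is SINGULAR FOR EVERY TABLE.
For 5-rows (`q = 2`, `N = |B₂(T)|`) a complete pair block on `n` states is thus singular as soon as `n > N + √(2N)`, a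
quarter of the five-row count. WHAT THIS IS NOT: no lower bound on the rank (the law's exactness is empirical); nothing on
joins beyond additivity over pieces; nothing on crux 14610 or VP ≠ VNP.
-/

set_option linter.dupNamespace false

namespace Summit.ValiantsHypothesis.ValiantsHypothesis.Theorems.BarrierLever.HiddenStates

open Finset

noncomputable section

namespace ShadowRank

variable {K h : ℕ} {n : Type*}

/-! ## Features, column-functions, the spanning family -/

/-- The feature `V` of the state `p`: the monomial `∏_{a ∈ V} tx p a`. -/
def feat (tx : Option (Fin K) → Fin h → ℂ) (p : Fin K) (V : Finset (Fin h)) : ℂ := ∏ a ∈ V, tx (some p) a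

/-- The pair column-function `Ψ_{p,V}`: on a pair column through `p`, the feature `V` of the other state. -/
def Psi (e : n → Finset (Fin K)) (tx : Option (Fin K) → Fin h → ℂ) (p : Fin K) (V : Finset (Fin h)) : n → ℂ :=
  fun k => if (e k).card = 2 ∧ p ∈ e k then ∑ p' ∈ (e k).erase p, feat tx p' V else 0

/-- The reduced column-function `Ψ''_{p,p₀}`: on a pair column through `p`, the `p₀`-coordinate of the other state. -/
def psi (e : n → Finset (Fin K)) (r : Fin K → Fin K → ℂ) (p p₀ : Fin K) : n → ℂ :=
  fun k => if (e k).card = 2 ∧ p ∈ e k then ∑ p' ∈ (e k).erase p, r p' p₀ else 0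

/-- Index of the spanning family: the columns off the pair level, (state of `S ∖ S₀`) × `S₀`, and `S₀.sym2`. -/
abbrev PIdx (e : n → Finset (Fin K)) (S S₀ : Finset (Fin K)) :=
  {k : n // (e k).card ≠ 2} ⊕ ((↥(S \ S₀) × ↥S₀) ⊕ ↥(S₀.sym2))

/-- `Ψ''` on an unordered pair of `S₀`, oriented increasingly. -/
def psiSym (e : n → Finset (Fin K)) (r : Fin K → Fin K → ℂ) : Sym2 (Fin K) → (n → ℂ) :=
  Sym2.lift ⟨fun a b => psi e r (min a b) (max a b), fun a b => by
    dsimp only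
    rw [min_comm, max_comm]⟩

/-- The spanning family. -/
def famVec [DecidableEq n] (e : n → Finset (Fin K)) (S S₀ : Finset (Fin K)) (r : Fin K → Fin K → ℂ) :
    PIdx e S S₀ → (n → ℂ)
  | Sum.inl k₀ => fun k => if k = k₀.1 then 1 else 0
  | Sum.inr (Sum.inl (p, p₀)) => psi e r p.1 p₀.1
  | Sum.inr (Sum.inr z) => psiSym e r z.1

/-! ## The antisymmetric relations and the span of the reduced column-functions -/

section relations

variable [DecidableEq n] (e : n → Finset (Fin K)) (S S₀ : Finset (Fin K)) (r : Fin K → Fin K → ℂ)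
  (heS : ∀ k, (e k).card = 2 → e k ⊆ S) (hS₀ : S₀ ⊆ S)
  (hδ : ∀ p ∈ S₀, ∀ p₀, r p p₀ = if p = p₀ then 1 else 0)

omit [DecidableEq n] in
include heS in
/-- **The antisymmetric relation**: `Σ_{p ∈ S} r(p,p₁) Ψ''_{p,p₂} = Σ_{p ∈ S} r(p,p₂) Ψ''_{p,p₁}`. -/
theorem psi_relation (p₁ p₂ : Fin K) (k : n) :
    ∑ p ∈ S, r p p₁ * psi e r p p₂ k = ∑ p ∈ S, r p p₂ * psi e r p p₁ k := by
  classical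
  by_cases hk : (e k).card = 2
  · -- both sides are the sum over ordered pairs of distinct states of the column
    have hred : ∀ p₁ p₂ : Fin K, ∑ p ∈ S, r p p₁ * psi e r p p₂ k =
        ∑ p ∈ e k, ∑ p' ∈ (e k).erase p, r p p₁ * r p' p₂ := by
      intro p₁ p₂
      rw [← Finset.sum_subset (heS k hk) (fun p _ hp => by simp [psi, hp])]
      refine Finset.sum_congr rfl fun p hp => ?_
      rw [psi, if_pos ⟨hk, hp⟩, Finset.mul_sum]
    rw [hred, hred, Finset.sum_comm' (t' := e k) (s' := fun p' => (e k).erase p')]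
    · exact Finset.sum_congr rfl fun p _ => Finset.sum_congr rfl fun p' _ => by ring
    · intro p p'
      simp only [Finset.mem_erase]
      tauto
  · simp [psi, hk]

omit [DecidableEq n] in
include heS hS₀ hδ in
/-- The relation solved for `Ψ''_{p₂,p₁}`, `p₁, p₂ ∈ S₀`. -/
theorem psi_swap (p₁ p₂ : Fin K) (hp₁ : p₁ ∈ S₀) (hp₂ : p₂ ∈ S₀) :
    psi e r p₂ p₁ = psi e r p₁ p₂ +
      ∑ p ∈ S \ S₀, (r p p₁ • psi e r p p₂ - r p p₂ • psi e r p p₁) := by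
  classical
  funext k
  have hrel := psi_relation e S r heS p₁ p₂ k
  rw [← Finset.sum_sdiff hS₀, ← Finset.sum_sdiff hS₀] at hrel
  have h1 : ∑ p ∈ S₀, r p p₁ * psi e r p p₂ k = psi e r p₁ p₂ k := by
    rw [Finset.sum_congr rfl fun p hp => by rw [hδ p hp p₁]]
    simp [hp₁]
  have h2 : ∑ p ∈ S₀, r p p₂ * psi e r p p₁ k = psi e r p₂ p₁ k := by
    rw [Finset.sum_congr rfl fun p hp => by rw [hδ p hp p₂]]
    simp [hp₂]
  rw [h1, h2] at hrel
  simp only [Pi.add_apply, Finset.sum_apply, Pi.sub_apply, Pi.smul_apply, smul_eq_mul, Finset.sum_sub_distrib]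
  linear_combination -hrel

include heS hS₀ hδ in
/-- Every reduced column-function `Ψ''_{p,p₀}` (`p ∈ S`, `p₀ ∈ S₀`) lies in the span of the family. -/
theorem psi_mem_span (p p₀ : Fin K) (hp : p ∈ S) (hp₀ : p₀ ∈ S₀) :
    psi e r p p₀ ∈ Submodule.span ℂ (Set.range (famVec e S S₀ r)) := by
  classical
  -- states outside `S₀`: members of the family
  have hout : ∀ p' ∈ S \ S₀, ∀ p₀' ∈ S₀,
      psi e r p' p₀' ∈ Submodule.span ℂ (Set.range (famVec e S S₀ r)) := fun p' hp' p₀' hp₀' =>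
    Submodule.subset_span ⟨Sum.inr (Sum.inl (⟨p', hp'⟩, ⟨p₀', hp₀'⟩)), rfl⟩
  -- increasing pairs inside `S₀`: members of the family
  have hle : ∀ a ∈ S₀, ∀ b ∈ S₀, a ≤ b →
      psi e r a b ∈ Submodule.span ℂ (Set.range (famVec e S S₀ r)) := by
    intro a ha b hb hab
    refine Submodule.subset_span ⟨Sum.inr (Sum.inr ⟨s(a, b), Finset.mk_mem_sym2_iff.mpr ⟨ha, hb⟩⟩), ?_⟩
    simp [famVec, psiSym, Sym2.lift_mk, min_eq_left hab, max_eq_right hab]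
  by_cases hpS₀ : p ∈ S₀
  · rcases le_or_gt p p₀ with hle' | hlt
    · exact hle p hpS₀ p₀ hp₀ hle'
    · rw [psi_swap e S S₀ r heS hS₀ hδ p₀ p hp₀ hpS₀]
      refine Submodule.add_mem _ (hle p₀ hp₀ p hpS₀ hlt.le) (Submodule.sum_mem _ fun p' hp' => ?_)
      exact Submodule.sub_mem _ (Submodule.smul_mem _ _ (hout p' hp' p hpS₀))
        (Submodule.smul_mem _ _ (hout p' hp' p₀ hp₀))
  · exact hout p (Finset.mem_sdiff.mpr ⟨hp, hpS₀⟩) p₀ hp₀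

end relations

/-! ## Coordinates on a maximal independent set of states -/

/-- **Coordinates.** A set `S₀ ⊆ S` of at most `N = #smallSets T q` states and coordinates `r` with `r = δ` on `S₀` and
`β_p = Σ_{p₀ ∈ S₀} r(p,p₀) β_{p₀}` for every `p ∈ S` (a maximal set of states with linearly independent features). -/
theorem exists_coords (S : Finset (Fin K)) (T : Finset (Fin h)) (q : ℕ) (tx : Option (Fin K) → Fin h → ℂ) :
    ∃ S₀ : Finset (Fin K), S₀ ⊆ S ∧ S₀.card ≤ (smallSets T q).card ∧ ∃ r : Fin K → Fin K → ℂ,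
      (∀ p ∈ S₀, ∀ p₀, r p p₀ = if p = p₀ then 1 else 0) ∧
      (∀ p ∈ S, ∀ V ∈ smallSets T q, feat tx p V = ∑ p₀ ∈ S₀, r p p₀ * feat tx p₀ V) := by
  classical
  -- feature vectors, zero outside `S`
  let v : Fin K → (↥(smallSets T q) → ℂ) := fun p => if p ∈ S then (fun V => feat tx p V.1) else 0
  obtain ⟨s₀, hli, hmax⟩ := exists_maximal_linearIndepOn ℂ v
  have hs₀S : ∀ p ∈ s₀, p ∈ S := by
    intro p hp
    by_contra hpS
    have hz : v p = 0 := by simp [v, hpS]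
    exact hli.linearIndependent.ne_zero ⟨p, hp⟩ hz
  let S₀ : Finset (Fin K) := Finset.univ.filter (· ∈ s₀)
  have hmemS₀ : ∀ p, p ∈ S₀ ↔ p ∈ s₀ := fun p => by simp [S₀]
  have hvS : ∀ p ∈ S, ∀ V : ↥(smallSets T q), v p V = feat tx p V.1 := fun p hp V => by simp [v, hp]
  refine ⟨S₀, fun p hp => hs₀S p ((hmemS₀ p).mp hp), ?_, ?_⟩
  · -- `|S₀| ≤ N`: independent vectors in an `N`-dimensional space
    have hli' : LinearIndependent ℂ (fun x : ↥S₀ => v x) := by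
      have hcomp := hli.linearIndependent.comp
        (fun x : ↥S₀ => (⟨x.1, (hmemS₀ x.1).mp x.2⟩ : ↥s₀)) (fun x y hxy => Subtype.ext (by
          have := congrArg Subtype.val hxy; exact this))
      exact hcomp
    have := hli'.fintype_card_le_finrank
    rwa [Module.finrank_fintype_fun_eq_card, Fintype.card_coe, Fintype.card_coe] at this
  · -- coordinates
    have hspan : ∀ p ∈ S, v p ∈ Submodule.span ℂ (v '' s₀) := by
      intro p hp
      by_cases hps : p ∈ s₀
      · exact Submodule.subset_span ⟨p, hps, rfl⟩
      · obtain ⟨a, ha, hav⟩ := hmax p hps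
        exact (Submodule.smul_mem_iff _ ha).mp hav
    have hl : ∀ p, ∃ l : Fin K →₀ ℂ, p ∈ S →
        l ∈ Finsupp.supported ℂ ℂ s₀ ∧ Finsupp.linearCombination ℂ v l = v p := by
      intro p
      by_cases hp : p ∈ S
      · obtain ⟨l, hl, hlv⟩ := (Finsupp.mem_span_image_iff_linearCombination ℂ).mp (hspan p hp)
        exact ⟨l, fun _ => ⟨hl, hlv⟩⟩
      · exact ⟨0, fun h' => absurd h' hp⟩
    choose l hl using hl
    refine ⟨fun p p₀ => if p ∈ S₀ then (if p = p₀ then 1 else 0) else l p p₀, fun p hp p₀ => by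
      simp only [hp, if_true], ?_⟩
    intro p hp V hV
    by_cases hpS₀ : p ∈ S₀
    · simp only [hpS₀, if_true, ite_mul, one_mul, zero_mul, Finset.sum_ite_eq, if_true]
    · simp only [hpS₀, if_false]
      obtain ⟨hsup, hcomb⟩ := hl p hp
      have hsupp : (l p).support ⊆ S₀ := fun p₀ hp₀ =>
        (hmemS₀ p₀).mpr (Finsupp.mem_supported _ _ |>.mp hsup (Finset.mem_coe.mpr hp₀))
      have hev := congrFun hcomb ⟨V, hV⟩
      rw [Finsupp.linearCombination_apply,
        Finsupp.sum_of_support_subset (l p) hsupp (fun i a => a • v i) (fun i _ => by simp)] at hev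
      rw [hvS p hp ⟨V, hV⟩] at hev
      rw [← hev, Finset.sum_apply]
      refine Finset.sum_congr rfl fun p₀ hp₀ => ?_
      rw [Pi.smul_apply, smul_eq_mul, hvS p₀ (hs₀S p₀ ((hmemS₀ p₀).mp hp₀)) ⟨V, hV⟩]

/-! ## Rows in the span, the count, the singular conclusion -/

section rows

variable [Fintype n] [DecidableEq n] (u : n → Finset (Fin h)) (e : n → Finset (Fin K)) (S S₀ : Finset (Fin K))
  (T : Finset (Fin h)) (q : ℕ) (tx : Option (Fin K) → Fin h → ℂ) (r : Fin K → Fin K → ℂ)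

omit [Fintype n] [DecidableEq n] in
/-- `Ψ_{p,V}` in coordinates: `Ψ_{p,V} = Σ_{p₀ ∈ S₀} β_{p₀}(V) • Ψ''_{p,p₀}`. -/
theorem Psi_eq_sum (heS : ∀ k, (e k).card = 2 → e k ⊆ S)
    (hcoord : ∀ p ∈ S, ∀ V ∈ smallSets T q, feat tx p V = ∑ p₀ ∈ S₀, r p p₀ * feat tx p₀ V)
    (p : Fin K) (V : Finset (Fin h)) (hV : V ∈ smallSets T q) :
    Psi e tx p V = ∑ p₀ ∈ S₀, feat tx p₀ V • psi e r p p₀ := by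
  classical
  funext k
  simp only [Finset.sum_apply, Pi.smul_apply, smul_eq_mul, Psi, psi]
  by_cases hk : (e k).card = 2 ∧ p ∈ e k
  · simp only [if_pos hk]
    rw [Finset.sum_congr rfl fun p' hp' => hcoord p' (heS k hk.1 (Finset.mem_of_mem_erase hp')) V hV,
      Finset.sum_comm]
    refine Finset.sum_congr rfl fun p₀ _ => ?_
    rw [Finset.mul_sum]
    exact Finset.sum_congr rfl fun _ _ => mul_comm _ _
  · simp [hk]

/-- **Every row of size `≤ s < 2(q+1)` inside `T` lies in the span of the family.** -/
theorem row_mem_span_pairs {s : ℕ} (hsq : s < 2 * (q + 1))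
    (heS : ∀ k, (e k).card = 2 → e k ⊆ S) (hS₀ : S₀ ⊆ S)
    (hδ : ∀ p ∈ S₀, ∀ p₀, r p p₀ = if p = p₀ then 1 else 0)
    (hcoord : ∀ p ∈ S, ∀ V ∈ smallSets T q, feat tx p V = ∑ p₀ ∈ S₀, r p p₀ * feat tx p₀ V)
    (i : n) (hiT : u i ⊆ T) (his : (u i).card ≤ s) :
    (fun k => ∏ a ∈ u i, (tx none a + ∑ p ∈ e k, tx (some p) a)) ∈
      Submodule.span ℂ (Set.range (famVec e S S₀ r)) := by
  classical
  have hfe : ∀ (p : Fin K) (V : Finset (Fin h)), ∏ a ∈ V, tx (some p) a = feat tx p V := fun _ _ => rfl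
  -- the decomposition of the row
  have hdec : (fun k => ∏ a ∈ u i, (tx none a + ∑ p ∈ e k, tx (some p) a)) =
      (∑ k₀ : {k : n // (e k).card ≠ 2},
          (∏ a ∈ u i, (tx none a + ∑ p ∈ e k₀.1, tx (some p) a)) • famVec e S S₀ r (Sum.inl k₀)) +
        ∑ p ∈ S, ∑ V ∈ smallSets T q, coef q tx (u i) {p} V • Psi e tx p V := by
    funext k
    simp only [Pi.add_apply, Finset.sum_apply, Pi.smul_apply, smul_eq_mul]
    by_cases hk : (e k).card = 2
    · -- a pair column: the indicator part vanishes, the rest is part 1's expansion, re-indexed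
      have h0 : ∑ k₀ : {k : n // (e k).card ≠ 2},
          (∏ a ∈ u i, (tx none a + ∑ p ∈ e k₀.1, tx (some p) a)) * famVec e S S₀ r (Sum.inl k₀) k = 0 := by
        refine Finset.sum_eq_zero fun k₀ _ => ?_
        have : k ≠ k₀.1 := fun hkk => k₀.2 (by rw [← hkk]; exact hk)
        simp [famVec, this]
      rw [h0, zero_add, prod_eq_sum_coef (q := q) (s := s) (t := 2) (by omega) tx hiT his hk]
      rw [← Finset.sum_subset (heS k hk) (fun p _ hp => by simp [Psi, hp])]
      -- both sides as a sum over ordered pairs of distinct states of the column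
      have hL : ∀ p ∈ e k, ∑ V ∈ T.powerset.filter (fun V => V.card ≤ q),
          coef q tx (u i) ((e k).erase p) V * ∏ a ∈ V, tx (some p) a =
          ∑ V ∈ smallSets T q, ∑ p' ∈ (e k).erase p, coef q tx (u i) {p'} V * feat tx p V := by
        intro p hp
        obtain ⟨p', hp'⟩ : ∃ p', (e k).erase p = {p'} :=
          Finset.card_eq_one.mp (by rw [Finset.card_erase_of_mem hp, hk])
        rw [hp']
        exact Finset.sum_congr rfl fun V _ => by rw [Finset.sum_singleton, hfe]
      have hR : ∀ p ∈ e k, ∑ V ∈ smallSets T q, coef q tx (u i) {p} V * Psi e tx p V k =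
          ∑ V ∈ smallSets T q, ∑ p' ∈ (e k).erase p, coef q tx (u i) {p} V * feat tx p' V := by
        intro p hp
        refine Finset.sum_congr rfl fun V _ => ?_
        rw [Psi, if_pos ⟨hk, hp⟩, Finset.mul_sum]
      rw [Finset.sum_congr rfl hL, Finset.sum_congr rfl hR, Finset.sum_comm,
        Finset.sum_comm (s := e k)]
      refine Finset.sum_congr rfl fun V _ => ?_
      rw [Finset.sum_comm' (t' := e k) (s' := fun p' => (e k).erase p')]
      intro p p'
      simp only [Finset.mem_erase]
      tauto
    · -- a column off the pair level: only its own indicator survives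
      have h1 : ∑ p ∈ S, ∑ V ∈ smallSets T q, coef q tx (u i) {p} V * Psi e tx p V k = 0 := by
        refine Finset.sum_eq_zero fun p _ => Finset.sum_eq_zero fun V _ => ?_
        simp [Psi, hk]
      rw [h1, add_zero, Finset.sum_eq_single ⟨k, hk⟩]
      · simp [famVec]
      · intro k₀ _ hk₀
        have : k ≠ k₀.1 := fun hkk => hk₀ (Subtype.ext hkk.symm)
        simp [famVec, this]
      · simp
  rw [hdec]
  refine Submodule.add_mem _ (Submodule.sum_mem _ fun k₀ _ =>
    Submodule.smul_mem _ _ (Submodule.subset_span ⟨Sum.inl k₀, rfl⟩)) ?_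
  refine Submodule.sum_mem _ fun p hp => Submodule.sum_mem _ fun V hV => Submodule.smul_mem _ _ ?_
  rw [Psi_eq_sum e S S₀ T q tx r heS hcoord p V hV]
  exact Submodule.sum_mem _ fun p₀ hp₀ =>
    Submodule.smul_mem _ _ (psi_mem_span e S S₀ r heS hS₀ hδ p p₀ hp hp₀)

omit [DecidableEq n] in
/-- The size of the spanning family. -/
theorem card_PIdx : Fintype.card (PIdx e S S₀) =
    (Finset.univ.filter fun k => (e k).card ≠ 2).card + ((S \ S₀).card * S₀.card + (S₀.card + 1).choose 2) := by
  classical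
  rw [Fintype.card_sum, Fintype.card_sum, Fintype.card_prod, Fintype.card_coe, Fintype.card_coe,
    Fintype.card_coe, Fintype.card_subtype, Finset.card_sym2]

/-- The arithmetic of the count: `(n − e)e + C(e+1,2) ≤ nN − C(N,2)` for `e ≤ N ≤ n`. -/
theorem count_le {d e N n : ℕ} (hde : d + e = n) (heN : e ≤ N) (hNn : N ≤ n) :
    d * e + (e + 1).choose 2 + N.choose 2 ≤ n * N := by
  obtain ⟨a, rfl⟩ := Nat.exists_eq_add_of_le heN
  obtain ⟨b, rfl⟩ := Nat.exists_eq_add_of_le hNn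
  have hd : d = a + b := by omega
  subst hd
  have h1 : 2 * (e + 1).choose 2 = e * (e + 1) := by
    rw [Nat.choose_two_right, Nat.add_sub_cancel, mul_comm (e + 1) e]
    exact Nat.two_mul_div_two_of_even (Nat.even_mul_succ_self e)
  have h2 : 2 * (e + a).choose 2 = (e + a) * (e + a - 1) := by
    rw [Nat.choose_two_right]
    exact Nat.two_mul_div_two_of_even (Nat.even_mul_pred_self (e + a))
  rcases Nat.eq_zero_or_pos (e + a) with hz | hpos
  · have he : e = 0 := by omega
    have ha : a = 0 := by omega
    subst he; subst ha; simp
  · have h3 : (e + a) * (e + a - 1) + (e + a) = (e + a) * (e + a) := by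
      obtain ⟨m, hm⟩ : ∃ m, e + a = m + 1 := ⟨e + a - 1, by omega⟩
      rw [hm, Nat.add_sub_cancel]; ring
    nlinarith [h1, h2, h3]

/-- **THE PAIR SPAN BOUND, singular form.** A hidden family whose two-state members live inside `S` (`|S| = n`), rows of
size `≤ s < 2(q+1)` inside `T`, `N = #{V ⊆ T : |V| ≤ q} ≤ n`: if `#{k : |e k| ≠ 2} + n·N < #columns + C(N,2)`, the
additive matrix is singular FOR EVERY TABLE. -/
theorem det_eq_zero_pairs {s : ℕ} (hsq : s < 2 * (q + 1))
    (heS : ∀ k, (e k).card = 2 → e k ⊆ S) (hus : ∀ i, (u i).card ≤ s) (huT : ∀ i, u i ⊆ T)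
    (hNS : (smallSets T q).card ≤ S.card)
    (hcount : (Finset.univ.filter fun k => (e k).card ≠ 2).card + S.card * (smallSets T q).card <
      Fintype.card n + ((smallSets T q).card).choose 2) :
    (Matrix.of fun i k : n => ∏ a ∈ u i, (tx none a + ∑ p ∈ e k, tx (some p) a)).det = 0 := by
  classical
  obtain ⟨S₀, hS₀, hcard₀, r, hδ, hcoord⟩ := exists_coords S T q tx
  set M : Matrix n n ℂ := Matrix.of fun i k : n => ∏ a ∈ u i, (tx none a + ∑ p ∈ e k, tx (some p) a) with hM
  by_contra hdet
  have hunit : IsUnit M := (Matrix.isUnit_iff_isUnit_det M).mpr (isUnit_iff_ne_zero.mpr hdet)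
  have hrows : LinearIndependent ℂ (fun i : n => M i) := Matrix.linearIndependent_rows_of_isUnit hunit
  set W : Submodule ℂ (n → ℂ) := Submodule.span ℂ (Set.range (famVec e S S₀ r)) with hW
  have hmem : ∀ i : n, M i ∈ W := fun i =>
    row_mem_span_pairs u e S S₀ T q tx r hsq heS hS₀ hδ hcoord i (huT i) (hus i)
  let w : n → W := fun i => ⟨M i, hmem i⟩
  have hw : LinearIndependent ℂ w := LinearIndependent.of_comp W.subtype hrows
  have h1 : Fintype.card n ≤ Module.finrank ℂ W := hw.fintype_card_le_finrank
  have h2 : Module.finrank ℂ W ≤ Fintype.card (PIdx e S S₀) := finrank_range_le_card (famVec e S S₀ r)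
  rw [card_PIdx] at h2
  have key := count_le (N := (smallSets T q).card) (Finset.card_sdiff_add_card_eq_card hS₀) hcard₀ hNS
  omega

end rows

end ShadowRank

end

end Summit.ValiantsHypothesis.ValiantsHypothesis.Theorems.BarrierLever.HiddenStates
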